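import Summits.BirchSwinnertonDyer.BirchSwinnertonDyer.Theorems.PrintCFramAnticyclotomicDescentThreeDefs
import HarnessLib

/-!
# The `p = 3` descent lemma `AnticyclotomicSpecialisationAtZpThree W` SPLIT into two PINNED pieces
# with a proved join: (A) the anticyclotomic elliptic-unit main conjecture at `Λ^ac`-level over a
# pinned relaxed `Λ`-adic Selmer datum, (B) the bottom-layer (`T = 0`) reading (cell `bsd-print-cfram`,
# D-0131 (2) PRINT tier, prover seat p1; line «acdescent3» on item `EllipticUnitIMCThree` =
# stmt-BirchSwinnertonDyer-21353, planner ask 2026-08-27T19:42Z «finer PINNED split ((3.8)–(3.9)@3 ·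
# (D5) · (D6)) with a proved join»; `--supports stmt-BirchSwinnertonDyer-21353`)

NOTHING is asserted: one hypothesis structure, two `@[conjecture]` `Prop`s per curve (plus slice
forms), and the PROVED joins. The pieces refine `AnticyclotomicSpecialisationAtZpThree W` (p559951):
its conclusion «∃ pinned datum `(ι, φ, Ω, 𝓔, D, c)` with the `T = 0` identity `n₀ + log₃ #X[T] = c`» is
reached in two steps through a PINNED intermediate object, the relaxed `Λ^ac`-adic compact Selmer
module `𝒮^ac_rel = lim←_n Sel_rel(K^ac_n, T)` of [BKNO] §3.2.2:

* `LambdaAdicRelaxedSelmerData V κ γ 𝔭` — HYPOTHESIS STRUCTURE (pattern and fields VERBATIM those of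
  the tree's `WeierstrassCurve.LambdaAdicSelmerData`, Perrin-Riou's `𝔖_p(K_∞)`, with the one change
  «compact Selmer ↦ compact Selmer RELAXED at `𝔭`», i.e. `compactSelmerOver ↦
  relaxedCompactSelmerOver … {𝔭}` of `BurungaleKobayashiNakamuraOta2026/AnticyclotomicEllipticUnitClass`):
  an abstract `Λ = ℤ_p⟦T⟧`-module `S` with projections to the finite-level relaxed compact Selmer
  groups pinning elements, the `T`-action (`γ − 1`), constants, continuity, norm compatibility, and
  `S ≅ {norm-compatible families}`. No term is constructed (existence = an inverse-limit construction,
  as for `LambdaAdicSelmerData`); the anticyclotomic class `z^ac` of a datum `D :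
  EllipticUnitClassData …` is the element `zac` with `proj n zac = D.z n` (unique by `ext`, exists by
  `surj` from `D.z_mem`, `D.z_norm`).
* (A) `AcMainConjectureAtZpThree W` — `@[conjecture]`: at every `3`-frame of analytic rank one, under
  [BKNO] §3.1.1's set-up (`h_K = 1`, `𝔭` unique), for every `(Φ, η)` with the defining properties of
  `η_E` at `3`, JLK's two-variable identity for `η` (VERBATIM as in the lemma) IMPLIES, on regime N
  (binders (A𝔭)₃, (Av)₃ verbatim): SOME pinned datum `(ι, φ, Ω ≠ 0, 𝓔, D)` (`L(φ,s) = L(W,s)`) such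
  that for EVERY relaxed `Λ^ac`-adic datum `𝒮` and every `zac ∈ 𝒮.S` projecting to `(D.z n)_n`:
  `𝒮.S/Λ·zac` and `X = XAc (W_K) 3 κ 𝔭 ∅ γ` are `Λ`-torsion and `char_Λ(𝒮.S/Λ·zac) = char_Λ(X)` —
  [BKNO] Prop. 3.7 (2)–(3) and Thm. 3.14 (3) AT `p = 3` with [JohnsonLeungKings2011] §5.4 in place of
  Rubin in Prop. 3.9 (2) (the pieces «(3.8)–(3.9)@3» = `z^ac ∈ 𝒮^ac_rel`, carried by `D.z_mem`, and
  «(D5)» = the char-level two-variable → anticyclotomic descent). PRE / beyond print at `3`.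
* (B) `AcBottomReadingAtZpThree W` — `@[conjecture]`: at every `3`-frame of analytic rank one, on
  regime N, for EVERY pinned datum `(ι, φ, Ω ≠ 0, 𝓔, D)` satisfying the conclusion of (A) (the
  `Λ^ac`-identity for all `𝒮`): `∃ c`, `D.HasBottomIndexExpZp c` and the `T = 0` identity
  `n₀ + log₃ #X[T] = c` whenever `ord₃ f(0) = n₀` and `X[T]` is finite — «(D6) + the `T = 0` reading»:
  Euler characteristic of `X` at `T = 0` (Greenberg LNM 1716 Lemma 4.2 shape), control of `𝒮/Λ·zac`
  at the bottom layer, and the `𝔭`-adic index dictionary (`d_𝔭`, `s`; lit DOSSIER §35/§37). Beyond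
  print at the ramified `3`.
* JOINS (PROVED, logic): `anticyclotomicSpecialisationAtZpThree_of_mainConjecture_of_bottomReading :
  AcMainConjectureAtZpThree W → AcBottomReadingAtZpThree W → AnticyclotomicSpecialisationAtZpThree W`,
  and on the slice `anticyclotomicSpecialisationThree_of_…`; hence (with p561883)
  `EllipticUnitIMCThree ⟸ sec54 ∧ (A)-slice ∧ (B)-slice`.

HONEST LIMITS. (i) The inhabitation caveat of hypothesis structures (REF R0.14): if no
`LambdaAdicRelaxedSelmerData (W.baseChange K) κ γ 𝔭` term exists, (A)'s last clause is vacuous and (B)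
carries the whole content — the split is then no finer than the lemma; constructing the datum (an
inverse limit, as `lambdaAdicSelmerData_exists_unique` does for the strict/usual one) is a separate,
provable task. (ii) (A) ∧ (B) ⟹ the lemma, not conversely (the pieces are genuinely intermediate).
(iii) JLK's fact keeps its reading flag `JLK11-sec54-Rubin-modules` (REF A61). Nothing is closed;
item 21353, regime N, C1 and the leaf stay OPEN. «beyond-print theorem»: NO.

References: [BurungaleKobayashiNakamuraOta2026] arXiv:2608.06879v1 §3.2.2 (`𝒮^ac_rel`, `X^ac_str`),
§3.3.1 (3.8)–(3.9), Prop. 3.7, Prop. 3.9 (2), §3.4 Props. 3.12–3.13, Thm. 3.14 (pp. 17–24) (claim;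
preprint); [PerrinRiou1987BSMF] §0 p. 402 (`𝔖_p(K_∞)` as a limit of compact Selmer groups);
[GreenbergLNM1716] §4 Lemma 4.2 (Euler characteristic); [JohnsonLeungKings2011] §5.4; tree
`WeierstrassCurve.LambdaAdicSelmerData` (HeegnerModuleIndex.lean), `Castella2018.AcSelmer.XAc`,
`EllipticUnitClassData`; cell PLAN v5, planner STATUS 2026-08-27T19:42:03Z.
-/

-- the summit namespace `Summit.BirchSwinnertonDyer.BirchSwinnertonDyer` repeats the problem name by design (D-0017)
set_option linter.dupNamespace false

noncomputable section

open scoped Classical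

open WeierstrassCurve NumberField IsDedekindDomain Field Module PowerSeries
  Literature.NumberTheory.GaloisRepresentations
  Literature.NumberTheory.EllipticCurves
  Literature.NumberTheory.EllipticCurves.Rank1Residual
  Literature.NumberTheory.EllipticCurves.Rank1Residual.Typed
  Literature.NumberTheory.EllipticCurves.Castella2018
  Literature.NumberTheory.EllipticCurves.BurungaleKobayashiNakamuraOta2026
  Literature.NumberTheory.EllipticCurves.KellerYin2024
  Literature.NumberTheory.ComplexMultiplication.EllipticUnits
  Literature.NumberTheory.ComplexMultiplication.EllipticUnits.JohnsonLeungKings2011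
  Literature.NumberTheory.NumberFields
  Summit.BirchSwinnertonDyer.Rank1Residual.Additive
  Summit.BirchSwinnertonDyer.Rank1Residual.X12.O11

namespace Summit.BirchSwinnertonDyer.BirchSwinnertonDyer.Theorems.PrintCFram.AcDescentThreeSplit

/-! ## §1 The pinned intermediate object: the relaxed `Λ`-adic compact Selmer datum -/

section Datum

variable {K : Type} [Field K] [NumberField K] {p : ℕ} [Fact p.Prime]

/-- **Relaxed `Λ`-adic Selmer data for `V/K` over the `ℤ_p`-extension `κ`, relaxed at `𝔭`**
(hypothesis structure; VERBATIM the tree's `WeierstrassCurve.LambdaAdicSelmerData` with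
`compactSelmerOver ↦ relaxedCompactSelmerOver … {𝔭}`): a term packages [BKNO]'s
`𝒮^ac_rel = lim←_{K ⊆ F ⊆ K^ac_∞} Sel_rel(F, T)` (§3.2.2; relaxed at `𝔭`, Kummer elsewhere) as an
abstract `Λ = ℤ_p⟦T⟧`-module `S` with projections `proj n : S → ∏_k H¹(Gal(K̄/K^ac_n), E[p^k])`
landing in the level-`n` relaxed compact Selmer group, the identities pinning the `Λ`-action (`T` as
`γ − 1`, constants through `ℤ_p → ℤ/p^k`, continuity) and norm compatibility, and `S ≅` the group of
norm-compatible families (`ext`, `surj`). EXISTENCE of such a datum (the inverse-limit construction) is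
NOT asserted here. [cite: BurungaleKobayashiNakamuraOta2026, §3.2.2 (arXiv:2608.06879v1 p. 18) (shape only)]
[cite: PerrinRiou1987BSMF, §0 p. 402 (compact Selmer groups in the limit)] -/
structure LambdaAdicRelaxedSelmerData (V : WeierstrassCurve K) (κ : ZpExtension K p)
    (γ : absoluteGaloisGroup K) (𝔭 : HeightOneSpectrum (𝓞 K)) where
  /-- The underlying type of `𝒮^ac_rel`. -/
  S : Type
  /-- `S` is an abelian group. -/
  [addCommGroup : AddCommGroup S]
  /-- `S` is a `Λ = ℤ_p⟦T⟧`-module. -/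
  [module : Module (IwasawaAlgebra p) S]
  /-- The projection to level `n`: `S → ∏_k H¹(Gal(K̄/K^ac_n), E[p^k])`. -/
  proj (n : ℕ) : S →+ Π k : ℕ, V.torsionH1Over ((p : ℤ) ^ k) (κ.layerSubgroup n)
  /-- `proj n` lands in the compact Selmer group RELAXED at `𝔭`: `Sel_rel(K^ac_n, T)`. -/
  proj_mem : ∀ n s, proj n s ∈ V.relaxedCompactSelmerOver (κ.layerSubgroup n) p {𝔭}
  /-- `T` acts as `γ - 1`. -/
  proj_X : ∀ n s, proj n ((PowerSeries.X : IwasawaAlgebra p) • s) =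
    V.conjPi p (κ.layerSubgroup n) γ (proj n s) - proj n s
  /-- Constants `c ∈ ℤ_p` act through `ℤ_p → ℤ/p^k` on the `k`-th components. -/
  proj_C : ∀ n s (c : ℤ_[p]), proj n (PowerSeries.C c • s) = V.padicPi p (κ.layerSubgroup n) c (proj n s)
  /-- Continuity: a power series without terms of degree `< k p^n` kills the `(n, k)` component. -/
  proj_cont : ∀ n k s (f : IwasawaAlgebra p), (∀ i < k * p ^ n, PowerSeries.coeff i f = 0) →
    proj n (f • s) k = 0
  /-- Norm compatibility: `res (x_n) = ∑_{i<p} conj_{γ^{p^n i}} (x_{n+1})`. -/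
  proj_norm : ∀ n s, V.resPi p (κ.layerSubgroup_antitone (Nat.le_succ n)) (proj n s) =
    ∑ i ∈ Finset.range p, V.conjPi p (κ.layerSubgroup (n + 1)) (γ ^ (p ^ n * i)) (proj (n + 1) s)
  /-- Joint injectivity of the projections. -/
  ext : ∀ s, (∀ n, proj n s = 0) → s = 0
  /-- Every norm-compatible family of relaxed compact Selmer elements comes from `S`. -/
  surj : ∀ x : (Π n k : ℕ, V.torsionH1Over ((p : ℤ) ^ k) (κ.layerSubgroup n)),
    (∀ n, x n ∈ V.relaxedCompactSelmerOver (κ.layerSubgroup n) p {𝔭}) →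
    (∀ n, V.resPi p (κ.layerSubgroup_antitone (Nat.le_succ n)) (x n) =
      ∑ i ∈ Finset.range p, V.conjPi p (κ.layerSubgroup (n + 1)) (γ ^ (p ^ n * i)) (x (n + 1))) →
    ∃ s, ∀ n, proj n s = x n

attribute [instance] LambdaAdicRelaxedSelmerData.addCommGroup LambdaAdicRelaxedSelmerData.module

/-- **The anticyclotomic class `z^ac` of an elliptic-unit datum LIVES in every relaxed `Λ`-adic datum**:
`∃! zac ∈ 𝒮.S` with `proj n zac = D.z n` for all `n` (existence by `surj` from `D.z_mem`, `D.z_norm`;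
uniqueness by `ext`). PROVED. [cite: BurungaleKobayashiNakamuraOta2026, (3.9) "z^ac ∈ 𝒮^ac_rel" (arXiv:2608.06879v1 p. 19) (claim; preprint)] -/
theorem LambdaAdicRelaxedSelmerData.existsUnique_proj_eq {W : WeierstrassCurve ℚ} [W.IsElliptic]
    {𝔭 : HeightOneSpectrum (𝓞 K)} {κ : ZpExtension K p} {γ : absoluteGaloisGroup K}
    {ι : PadicAlgCl p ≃+* ℂ} {φ : HeckeCharacter K} {Ω : ℂ} {𝓔 : AcDualExpSystem W p K 𝔭 κ ι}
    (𝒮 : LambdaAdicRelaxedSelmerData (W.baseChange K) κ γ 𝔭)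
    (D : EllipticUnitClassData W p K 𝔭 κ γ ι φ Ω 𝓔) :
    ∃! zac : 𝒮.S, ∀ n, 𝒮.proj n zac = D.z n := by
  obtain ⟨s, hs⟩ := 𝒮.surj D.z D.z_mem D.z_norm
  refine ⟨s, hs, fun t ht ↦ ?_⟩
  have h0 : t - s = 0 := 𝒮.ext _ fun n ↦ by rw [map_sub, ht n, hs n, sub_self]
  exact sub_eq_zero.mp h0

end Datum

/-! ## §2 The two pinned pieces at a curve `W` of the `p = 3` slice -/

variable (W : WeierstrassCurve ℚ) [W.IsElliptic] [W.IsGloballyMinimal]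

/-- **(A) The anticyclotomic elliptic-unit MAIN CONJECTURE at `Λ^ac`-level, at the ramified `3`,
RELATIVE to JLK's two-variable identity for `η_E`** (`@[conjecture]`, NOTHING asserted). Binders:
exactly those of `AnticyclotomicSpecialisationAtZpThree W` (3-frame of analytic rank one; `h_K = 1`,
`𝔭` unique; `(Φ, η)` with the defining properties of `η_E` at `3`; JLK's identity for `η` VERBATIM;
anticyclotomic `κ`, generator `γ`; regime-N binders (A𝔭)₃, (Av)₃). Conclusion: SOME pinned datum
`(ι, φ, Ω ≠ 0, 𝓔, D)` (`L(φ, s) = L(W, s)`) such that for EVERY relaxed `Λ^ac`-adic datum `𝒮` and every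
`zac ∈ 𝒮.S` with `proj n zac = D.z n`: `𝒮.S / Λ·zac` and `X = XAc (W_K) 3 κ 𝔭 ∅ γ` are `Λ`-torsion and
`char_Λ(𝒮.S / Λ·zac) = char_Λ(X)` — [BKNO] Prop. 3.7 (2)–(3) + Thm. 3.14 (3) at `p = 3` with
[JohnsonLeungKings2011] §5.4 (reading flag `JLK11-sec54-Rubin-modules`) replacing Rubin in Prop. 3.9 (2)
(«(3.8)–(3.9)@3» is carried by `D.z_mem`; «(D5)» = the char-level descent `Λ₂ → Λ^ac`). Inhabitation
caveat: vacuous in `𝒮` if no relaxed datum exists (module docstring (i)). PRE / beyond print at `3`.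
OPEN. **ERRATUM — SUPERSEDED (cell referee R0.25, planner 2026-08-27T20:53Z, found by prover p2 g3):
this (A) is MIS-CUT and is NOT a registered stub.** `Submodule.span Λ {zac}` is the CYCLIC
`Λ = ℤ₃⟦T⟧`-span (`Λ`-rank `≤ 1`), while `𝒮.S ≅ 𝒮^ac_rel` has `Λ_𝒪`-rank one ([BKNO] Prop. 3.7 (3)),
i.e. `Λ`-rank `2` in this CM setting, so `𝒮.S ⧸ Λ·zac` is never `Λ`-torsion (relaxed data exist,
`nonempty_lambdaAdicRelaxedSelmerData`): the first conjunct below is unsatisfiable and (B)'s antecedent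
is void. The registered stubs of line «acdescent3» (v3) are the REPAIRED pair (A𝒪)
`AcDescentThreeOrbit.AcMainConjectureOrbitAtZpThree` / (B𝒪) `AcDescentThreeOrbit.AcBottomReadingOrbitAtZpThree`
of `PrintCFramAcDescentThreeSplitOrbit.lean`, which quotient by the `End_K(E_K)`-orbit span
`endOrbitSpan 𝒮 D.z` (= `Λ_𝒪 · z^ac`; same ring as `padicEndSpan` downstairs). This declaration is kept
verbatim as the documented mis-cut (append-only tree).
[cite: BurungaleKobayashiNakamuraOta2026, Prop. 3.7 (2)–(3), Prop. 3.9 (2), Thm. 3.14 (3) (arXiv:2608.06879v1 pp. 19–24) (claim; preprint; shape only)]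
[cite: JohnsonLeungKings2011, §5.4 (arXiv:0804.2828 p0016:L19–26) (the antecedent; shape only)] -/
@[conjecture] def AcMainConjectureAtZpThree : Prop :=
  ∀ (K : Type) [Field K] [NumberField K] (𝔭 : HeightOneSpectrum (𝓞 K))
    (W' : WeierstrassCurve ℚ) [W'.IsElliptic] [W'.IsGloballyMinimal] (C : VariableChange ℚ),
    IsFrameThree W K 𝔭 W' C → W.analyticRank = 1 →
    NumberField.classNumber K = 1 →
    (∀ w : HeightOneSpectrum (𝓞 K), ((3 : ℕ) : 𝓞 K) ∈ w.asIdeal → w = 𝔭) →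
    ∀ (Φ : AddSubgroup (W.baseChange K).geomPoints)
      (η : FramedGaloisRep K (padicCoeffIntegers (∅ : Set (PadicAlgCl 3))) 1),
      Nat.card Φ = 3 → Φ ≤ geomTorsion (W.baseChange K) (3 : ℤ) →
      (∀ σ : absoluteGaloisGroup K, ∀ P ∈ Φ, σ • P ∈ Φ) →
      IsResidualPairOver (W.baseChange K) 3 η η → IsTeichmullerLiftOn ∅ Φ η →
      (∀ σ : absoluteGaloisGroup K, η σ = 1 ↔ ∀ P ∈ Φ, σ • P = P) →
      (∀ {K₀ : IntermediateField K (AlgebraicClosure K)},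
        K₀.fixingSubgroup = (η.toMonoidHom.ker).map (absoluteGaloisGroup.toAlgEquiv K).toMonoidHom →
        ∀ {κ₁ κ₂ : ZpExtension K 3} {γ₁ γ₂ : absoluteGaloisGroup K},
          ZpExtension.IsTopGeneratorPair κ₁ κ₂ γ₁ γ₂ → η γ₁ = 1 → η γ₂ = 1 →
          ∀ (ι : K →+* ℂ) (D : ClassGroupDualData₂ κ₁ κ₂ η γ₁ γ₂)
            (E : UnitIndexData₂ ι K₀ κ₁ κ₂ η γ₁ γ₂),
            Module.Finite (IwasawaAlgebra₂ 3) D.X ∧ Module.IsTorsion (IwasawaAlgebra₂ 3) D.X ∧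
              Module.Finite (IwasawaAlgebra₂ 3) E.Q ∧ Module.IsTorsion (IwasawaAlgebra₂ 3) E.Q ∧
              Module.charIdeal (IwasawaAlgebra₂ 3) D.X = Module.charIdeal (IwasawaAlgebra₂ 3) E.Q) →
      ∀ (κ : ZpExtension K 3), κ.IsAnticyclotomic →
        ∀ (γ : absoluteGaloisGroup K) [Fact (κ.IsTopGenerator γ)],
          (∀ Q : (W.baseChange ℚ_[3]).toAffine.Point, (3 : ℕ) • Q = 0 → Q = 0) →
          (∀ Q : (W'.baseChange ℚ_[3]).toAffine.Point, (3 : ℕ) • Q = 0 → Q = 0) →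
          (∀ v : HeightOneSpectrum (𝓞 K), ((3 : ℕ) : 𝓞 K) ∉ v.asIdeal →
            v.asIdeal.ramificationIdx (𝓞 ℚ) = 1 → v.asIdeal.inertiaDeg (𝓞 ℚ) = 1 →
            (W.baseChange K).HasGoodReductionAt v ∨
              ∀ R : ((W.baseChange K).baseChange (v.adicCompletion K)).toAffine.Point,
                (3 : ℕ) • R = 0 → R = 0) →
          ∃ (ι : PadicAlgCl 3 ≃+* ℂ) (φ : HeckeCharacter K) (Ω : ℂ) (𝓔 : AcDualExpSystem W 3 K 𝔭 κ ι)
            (D : EllipticUnitClassData W 3 K 𝔭 κ γ ι φ Ω 𝓔),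
            Ω ≠ 0 ∧ (∀ s : ℂ, 3 / 2 < s.re → heckeLFunction φ s = W.LSeries s) ∧
            ∀ (𝒮 : LambdaAdicRelaxedSelmerData (W.baseChange K) κ γ 𝔭) (zac : 𝒮.S),
              (∀ n, 𝒮.proj n zac = D.z n) →
              Module.IsTorsion (IwasawaAlgebra 3) (𝒮.S ⧸ Submodule.span (IwasawaAlgebra 3) {zac}) ∧
              Module.IsTorsion (IwasawaAlgebra 3) (AcSelmer.XAc (W.baseChange K) 3 κ 𝔭 ∅ γ) ∧
              Module.charIdeal (IwasawaAlgebra 3) (𝒮.S ⧸ Submodule.span (IwasawaAlgebra 3) {zac}) =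
                Module.charIdeal (IwasawaAlgebra 3) (AcSelmer.XAc (W.baseChange K) 3 κ 𝔭 ∅ γ)

/-- **(B) The BOTTOM-LAYER (`T = 0`) READING at the ramified `3`** (`@[conjecture]`, NOTHING asserted):
at every `3`-frame of analytic rank one, on regime N (binders (A𝔭)₃, (Av)₃), for EVERY pinned datum
`(ι, φ, Ω ≠ 0, 𝓔, D)` (`L(φ, s) = L(W, s)`) satisfying the `Λ^ac`-IDENTITY of (A) (for all relaxed
`Λ^ac`-adic data `𝒮` and all `zac` projecting to `(D.z n)_n`: torsion and
`char_Λ(𝒮.S / Λ·zac) = char_Λ(XAc …)`), there is `c` with `D.HasBottomIndexExpZp c` and the `T = 0`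
identity `n₀ + log₃ #X[T] = c` whenever `ord₃ f(0) = n₀` and `X[T]` is finite — «(D6) + the `T = 0`
reading»: the Euler characteristic of `X` at `T = 0`, control of `𝒮 / Λ·zac` at the bottom layer
(`𝒮 → Sel_rel(K, T) ⊇ tors + 𝒪_𝔭·z(𝟙)`), and the `𝔭`-adic index dictionary (`d_𝔭`, `s`). Beyond
print at the ramified `3`; carries the whole content if no relaxed datum exists (module docstring (i)).
OPEN. **ERRATUM — SUPERSEDED (cell referee R0.25): the antecedent below is (A)'s mis-cut conclusion
(torsion of `𝒮.S ⧸ Λ·zac` for the cyclic `Λ`-span — unsatisfiable, see the erratum on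
`AcMainConjectureAtZpThree`), so this (B) is VACUOUSLY TRUE and is NOT a registered stub; the registered
piece is (B𝒪) `AcDescentThreeOrbit.AcBottomReadingOrbitAtZpThree` (same text over the orbit span
`endOrbitSpan 𝒮 D.z`).** [cite: GreenbergLNM1716, §4 Lemma 4.2 (p. 85) (Euler characteristic; shape only)]
[cite: BurungaleKobayashiNakamuraOta2026, §3.2.2 and Thm. 3.14 (arXiv:2608.06879v1 pp. 18, 24) (claim; preprint; shape only)] -/
@[conjecture] def AcBottomReadingAtZpThree : Prop :=
  ∀ (K : Type) [Field K] [NumberField K] (𝔭 : HeightOneSpectrum (𝓞 K))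
    (W' : WeierstrassCurve ℚ) [W'.IsElliptic] [W'.IsGloballyMinimal] (C : VariableChange ℚ),
    IsFrameThree W K 𝔭 W' C → W.analyticRank = 1 →
    ∀ (κ : ZpExtension K 3), κ.IsAnticyclotomic →
      ∀ (γ : absoluteGaloisGroup K) [Fact (κ.IsTopGenerator γ)],
        (∀ Q : (W.baseChange ℚ_[3]).toAffine.Point, (3 : ℕ) • Q = 0 → Q = 0) →
        (∀ Q : (W'.baseChange ℚ_[3]).toAffine.Point, (3 : ℕ) • Q = 0 → Q = 0) →
        (∀ v : HeightOneSpectrum (𝓞 K), ((3 : ℕ) : 𝓞 K) ∉ v.asIdeal →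
          v.asIdeal.ramificationIdx (𝓞 ℚ) = 1 → v.asIdeal.inertiaDeg (𝓞 ℚ) = 1 →
          (W.baseChange K).HasGoodReductionAt v ∨
            ∀ R : ((W.baseChange K).baseChange (v.adicCompletion K)).toAffine.Point,
              (3 : ℕ) • R = 0 → R = 0) →
        ∀ (ι : PadicAlgCl 3 ≃+* ℂ) (φ : HeckeCharacter K) (Ω : ℂ) (𝓔 : AcDualExpSystem W 3 K 𝔭 κ ι)
          (D : EllipticUnitClassData W 3 K 𝔭 κ γ ι φ Ω 𝓔),
          Ω ≠ 0 → (∀ s : ℂ, 3 / 2 < s.re → heckeLFunction φ s = W.LSeries s) →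
          (∀ (𝒮 : LambdaAdicRelaxedSelmerData (W.baseChange K) κ γ 𝔭) (zac : 𝒮.S),
            (∀ n, 𝒮.proj n zac = D.z n) →
            Module.IsTorsion (IwasawaAlgebra 3) (𝒮.S ⧸ Submodule.span (IwasawaAlgebra 3) {zac}) ∧
            Module.IsTorsion (IwasawaAlgebra 3) (AcSelmer.XAc (W.baseChange K) 3 κ 𝔭 ∅ γ) ∧
            Module.charIdeal (IwasawaAlgebra 3) (𝒮.S ⧸ Submodule.span (IwasawaAlgebra 3) {zac}) =
              Module.charIdeal (IwasawaAlgebra 3) (AcSelmer.XAc (W.baseChange K) 3 κ 𝔭 ∅ γ)) →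
          ∃ c : ℕ, D.HasBottomIndexExpZp c ∧
            ∀ (n₀ : ℕ), AcSelmer.XAc.HasCharValuationAt (W.baseChange K) 3 κ 𝔭 ∅ γ n₀ →
              Finite {x : AcSelmer.XAc (W.baseChange K) 3 κ 𝔭 ∅ γ //
                (PowerSeries.X : IwasawaAlgebra 3) • x = 0} →
              (n₀ : ℤ) + padicValNat 3 (Nat.card {x : AcSelmer.XAc (W.baseChange K) 3 κ 𝔭 ∅ γ //
                  (PowerSeries.X : IwasawaAlgebra 3) • x = 0}) = c

/-! ## §3 The proved join at a curve `W` -/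

variable {W}

omit [W.IsGloballyMinimal] in
/-- **(A) ∧ (B) ⟹ the descent lemma `AnticyclotomicSpecialisationAtZpThree W`** (PROVED; logic over
the shared binders: (A) yields the pinned datum with the `Λ^ac`-identity, (B) reads it at `T = 0`).
[cite: BurungaleKobayashiNakamuraOta2026, Thm. 3.14 (3) (arXiv:2608.06879v1 p. 24) (claim; preprint; shape only)] -/
theorem anticyclotomicSpecialisationAtZpThree_of_mainConjecture_of_bottomReading
    (hA : AcMainConjectureAtZpThree W) (hB : AcBottomReadingAtZpThree W) :
    AnticyclotomicDescentThree.AnticyclotomicSpecialisationAtZpThree W := by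
  intro K _ _ 𝔭 W' _ _ C hF hr hh huniq Φ η hcard hle hstab hpair hlift hker hJLK κ hκ γ _ hA𝔭 hA𝔭' hAv
  obtain ⟨ι, φ, Ω, 𝓔, D, hΩ, hL, hIMC⟩ :=
    hA K 𝔭 W' C hF hr hh huniq Φ η hcard hle hstab hpair hlift hker hJLK κ hκ γ hA𝔭 hA𝔭' hAv
  obtain ⟨c, hc, hT0⟩ := hB K 𝔭 W' C hF hr κ hκ γ hA𝔭 hA𝔭' hAv ι φ Ω 𝓔 D hΩ hL hIMC
  exact ⟨ι, φ, Ω, 𝓔, D, c, hΩ, hL, hc, hT0⟩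

/-- **(A) ∧ (B) ∧ JLK's named fact ⟹ the Zp₃ carrier (R-IMC)∃-Zp₃ at `W`** (PROVED: the join
composed with p559951's `ramifiedCMEllipticUnitIMCAtZpThree_of_sec54_of_specialisation`).
[cite: JohnsonLeungKings2011, §5.4 (arXiv:0804.2828 p0016:L19–26)]
[cite: BurungaleKobayashiNakamuraOta2026, Thm. 3.14 (3) (arXiv:2608.06879v1 p. 24) (claim; preprint)] -/
theorem ramifiedCMEllipticUnitIMCAtZpThree_of_sec54_of_mainConjecture_of_bottomReading
    (h54 : sec54_charIdeal_classGroup_eq_unitIndex)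
    (hA : AcMainConjectureAtZpThree W) (hB : AcBottomReadingAtZpThree W) :
    RamifiedCMEllipticUnitIMCAtZpThree W :=
  AnticyclotomicDescentThree.ramifiedCMEllipticUnitIMCAtZpThree_of_sec54_of_specialisation h54
    (anticyclotomicSpecialisationAtZpThree_of_mainConjecture_of_bottomReading hA hB)

/-! ## §4 Slice forms and the join on the slice -/

/-- **(A) on the whole `p = 3` slice** (binders of item 21353). `@[conjecture]`, nothing asserted.
[cite: BurungaleKobayashiNakamuraOta2026, Thm. 3.14 (3) (arXiv:2608.06879v1 p. 24) (claim; preprint; shape only)] -/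
@[conjecture] def AcMainConjectureThree : Prop :=
  ∀ (W : WeierstrassCurve ℚ) [W.IsElliptic] [W.IsGloballyMinimal],
    W.HasCM → CMRamified W 3 → W.analyticRank = 1 → AcMainConjectureAtZpThree W

/-- **(B) on the whole `p = 3` slice** (binders of item 21353). `@[conjecture]`, nothing asserted.
[cite: GreenbergLNM1716, §4 Lemma 4.2 (p. 85) (shape only)] -/
@[conjecture] def AcBottomReadingThree : Prop :=
  ∀ (W : WeierstrassCurve ℚ) [W.IsElliptic] [W.IsGloballyMinimal],
    W.HasCM → CMRamified W 3 → W.analyticRank = 1 → AcBottomReadingAtZpThree W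

/-- **(A)-slice ∧ (B)-slice ⟹ the slice lemma `AnticyclotomicSpecialisationThree`** (PROVED join) —
so, with p561883's `ellipticUnitIMCThree_of_sec54_of_specialisation`, item 21353 ⟸ JLK's named
fact ∧ (A) ∧ (B). [cite: BurungaleKobayashiNakamuraOta2026, Thm. 3.14 (3) (arXiv:2608.06879v1 p. 24) (claim; preprint; shape only)] -/
theorem anticyclotomicSpecialisationThree_of_mainConjecture_of_bottomReading
    (hA : AcMainConjectureThree) (hB : AcBottomReadingThree) :
    AnticyclotomicDescentThree.AnticyclotomicSpecialisationThree :=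
  fun W _ _ hCM hram hr ↦
    anticyclotomicSpecialisationAtZpThree_of_mainConjecture_of_bottomReading (hA W hCM hram hr)
      (hB W hCM hram hr)

/-- **The body of item 21353 from JLK's named fact ∧ (A)-slice ∧ (B)-slice** (PROVED; verbatim the
body of `Theses.PrintCFram.EllipticUnitIMCThree`; the route-level statement is the one-liner
`ellipticUnitIMCThree_of_sec54_of_specialisation h54 (anticyclotomicSpecialisationThree_of_… hA hB)`
of p561883's file). [cite: JohnsonLeungKings2011, §5.4 (arXiv:0804.2828 p0016:L19–26)]
[cite: BurungaleKobayashiNakamuraOta2026, Thm. 3.14 (3) (arXiv:2608.06879v1 p. 24) (claim; preprint)] -/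
theorem forall_imcAtZpThree_of_sec54_of_mainConjecture_of_bottomReading
    (h54 : sec54_charIdeal_classGroup_eq_unitIndex) (hA : AcMainConjectureThree)
    (hB : AcBottomReadingThree) :
    ∀ (W : WeierstrassCurve ℚ) [W.IsElliptic] [W.IsGloballyMinimal],
      W.HasCM → CMRamified W 3 → W.analyticRank = 1 → RamifiedCMEllipticUnitIMCAtZpThree W :=
  AnticyclotomicDescentThree.forall_imcAtZpThree_of_sec54_of_specialisationThree h54
    (anticyclotomicSpecialisationThree_of_mainConjecture_of_bottomReading hA hB)

end Summit.BirchSwinnertonDyer.BirchSwinnertonDyer.Theorems.PrintCFram.AcDescentThreeSplit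

end
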